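import Summits.RiemannHypothesis.RiemannHypothesis.Theorems.LiCoefficientsDefs
import Literature.NumberTheory.LFunctions.RiemannXiLogDeriv
import Literature.NumberTheory.LFunctions.Equivalents
import Literature.NumberTheory.LFunctions.ZetaZeros
import HarnessLib

/-!
# RiemannHypothesis / LI column — vocabulary PART D and the rung leaf «Li PRIME-ECHO LAW» (RH-FREE, all `n`)

Cell `pub/rh-li` (D-0040/D-0059/D-0061), theory memo `theory/TARGETS.md` §7.6–§7.14 and §12 (gens 2–6).
Statement-only module (`def`s + `@[conjecture]` targets + PROVED glue; no `sorry`, no axioms), the successor of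
PART A/B (`Theorems/LiCoefficientsDefs.lean`) and PART C (`Theorems/LiAsymptoticDefs.lean`).  It types the column's
DATA-ROW OBJECT — «the law of the oscillatory arithmetic part of `λ_n`» — as an RH-FREE THEOREM TARGET about the
zeros alone.

THE LAW (leaf `LiZeroWindowEcho`, T3d of the memo).  Write `z_ρ = 1 − 1/ρ`, `θ(t) = 2 arctan(1/2t)` (`liZeroAngle`,
PART A) and `ϑ'(t) = ½ Re ψ(¼ + it/2) − ½ log π` (`liGammaDensity`).  For every fixed `c ≥ 5/4` and all `n ≥ 2`,
`Σ_{√n < |Im ρ| ≤ c√n} Re m_ρ z_ρ^n − (2/π) ∫_{√n}^{c√n} cos(nθ(t)) ϑ'(t) dt = −A₂ n^{1/4} cos(2√(n log 2) + π/4) + O_c(log² n)`,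
`A₂ = (log 2)^{1/4}/√(2π) = 0.36400…` (`liEchoAmp`; `liPrimeEcho 2 n` is the right-hand chirp, `liPrimeEcho_two`).
In words: the zeros of height `(√n, c√n]`, summed with the Li weight and compared with their Riemann–von Mangoldt
density, CHIRP THE PRIME 2 — the Li kernel's phase `n/t` resonates with the prime-power frequency `log m` at the
height `t₀(m) = √(n/log m)`, and `t₀(2) = 1.2011 √n` is the only stationary height in the window (`t₀(3) = 0.954 √n`).

RH-FREE FOR ALL `n` (rule 4 label): every zero of the window is summed WHATEVER ITS REAL PART, and the Li weight is
bounded there unconditionally (`|z_ρ^n| = (1 + (1 − 2β)/|ρ|²)^{n/2} ≤ e^{1/2}` for `|Im ρ| ≥ √n`); the contour proof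
below never uses the position of the zeros.  The truth value of the leaf does not depend on RH and nothing here
bears on the truth of RH; it is PROOF-OF-DATA for the column's data row (the `n^{1/4}` «cutoff echo» seen in the
certified `λ_n` tables, kit j241040/j241041, and then in the zeros alone, kit j241673/j242323/j242449: free-fit
amplitude 0.3639 vs `A₂ = 0.3640`, phase 0.792 vs `π/4 = 0.785`, `c = 2`, `10⁴ ≤ n ≤ 10⁶`; NO chirp for `c = 1.10`,
amplitude 0.006; second, CERTIFIED lineage rh-li-eng g2, kit j247551/j247639, Arb zeros to `γ = 23 009`, `n ≤ 4·10⁸`: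
echo amplitudes of the windows `(0.752√n, 1.08√n]` (primes 3, 4, 5) `0.3339/0.1528/0.2845` vs the derived
`E_m` constants `0.3335/0.1530/0.2842`, phases `0.787/0.789/0.790`, remainder `D − ΣE_m` of rms `≈ 0.6`, `sup ≤ 2.5`
on every band — the typed `O(log² n)` is empirically `O(1)`; and the resonant `m = 2` piece of `liPrimeEdge` evaluated
directly (theory g6, `li_echo2_local.py`) matches `+liPrimeEcho 2 n` in SIGN and size: `−9.71` vs `−9.63` at `n = 5·10⁵`).  It is NOT height-buying (no verified height enters) and NOT a restatement of Li/Weil positivity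
(ref2 g6 tautology test PASS, 2026-08-25T18:00Z).

MECHANISM (route `Theses/LiPrimeEcho.lean`, cruxes over the contour vocabulary below; Bombieri's explicit-formula
rectangle with the NON-decaying weight `F_n(s) = (1 − 1/s)^n`, tree pattern `WeilExplicitRightEdge.lean`):
residues of `F_n ξ'/ξ` on `[−1/2, 3/2] × [T₁, T₂]` at good heights (`integral_boundary_rect_logDeriv_mul`), left
edge folded by `ξ'/ξ(1 − s) = −ξ'/ξ(s)` and conjugation (`logDeriv_riemannXi_one_sub/_conj`): `liZeroTraceWindow =
liRightEdge + liHorizTerm T₁ − liHorizTerm T₂`; on `Re w = 3/2`, `ξ'/ξ = 1/w + 1/(w−1) + (−½ log π + ½ ψ(w/2)) −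
L(Λ, w)` (`logDeriv_riemannXi_eq_of_one_lt_re`) splits the right edge into POLAR (`O(1)`), GAMMA (shifted to
`Re w = ½`, where it IS `liSmoothTraceWindow`, cost `O(log n)`) and PRIME pieces; in the prime piece every `m ≥ 3`
and the `F_n(w)`-half are non-stationary (`O(1)`), and `m = 2` in the `F_n(1 − w)`-half is a weighted stationary
phase (`weightedStationaryPhase_sharp`, `fresnelC_eq`) giving `+liPrimeEcho 2 n + O(log n)`; horizontal edges
`O(log² n)` at good heights (`exists_norm_logDeriv_riemannXi_le`, Landau–Gonek pattern).  Sources: Lagarias 2007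
(Ann. Inst. Fourier 57) §§3–4 (the `(1 − 1/s)^n` contour, under RH, for the trend); Bombieri–Lagarias 1999 Thm 1
(`keiperLiCoeff_eq_zero_sum_holds`); Gonek 1993 / Landau 1911 (`Σ_γ x^ρ`, the un-chirped ancestor); Keiper 1992,
Maślanka 2004, Coffey 2005, Voros 2006/2018, Arias de Reyna 2011 (numerics and asymptotics of `λ_n`; none isolates
an `n^{1/4}` prime chirp of a zero window — novelty record in the route header).

FENCES.  (i) RH-EQUIVALENT statements of the column (`li_criterion_holds`; `λ_n`'s full asymptotics for all `n`)
are NOT targets here.  (ii) The leaf concerns a WINDOW of zeros at height `≍ √n`; it says nothing about zeros off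
the line and is consistent with any zero configuration obeying the known density theorems.  (iii) Companions typed
below (`LiZeroWindowEchoBare`, `LiSmoothTraceWindowBound`, `LiZeroWindowSilent`, `LiZeroWindowEchoes`,
`LiZeroWindowEchoTwo`) are targets of the same family, NOT items of the route; the PROVED glue
(`liZeroWindowEcho_of_bare`, `liZeroWindowEcho_of_echoes`, `liZeroWindowSilent_of_echoes`, `liZeroWindowEchoTwo_of`)
records how they hang together: the leaf is the `m = 2` instance of the general echo law `LiZeroWindowEchoes`.
-/

noncomputable section

-- D-0017: `Summit.<S>.<S>.…` is the designed namespace of a single-problem summit.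
set_option linter.dupNamespace false

open MeasureTheory intervalIntegral
open scoped ArithmeticFunction.vonMangoldt ComplexConjugate

namespace Summit.RiemannHypothesis.RiemannHypothesis.Theorems.LiTheory

open Literature.NumberTheory.LFunctions

/-! ## PART D — vocabulary of the prime-echo law (bodies verbatim from `theory/KeiperLiSplitTargetsV2.lean`, the
vocabulary of record vetted by rh-columns-ref2 g5/g6; `liZeroAngle` is PART A's) -/

/-- The Li ZERO TRACE up to height `T`: `Re Σ_{ρ ∈ liZeroBox T} m_ρ (1 − 1/ρ)^n` (all zeros of the symmetric box,
with multiplicity, whatever their real part; `λ_n = lim_T [2N(T) − liZeroTrace n T]` by `keiperLiCoeff_eq_zero_sum`). -/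
def liZeroTrace (n : ℕ) (T : ℝ) : ℝ :=
  (∑ᶠ ρ ∈ liZeroBox T, (riemannZetaZeroOrder ρ : ℂ) * (1 - 1 / ρ) ^ n).re

/-- The WINDOWED zero trace `Re Σ_{ρ ∈ liZeroBox T₂ ∖ liZeroBox T₁} m_ρ (1 − 1/ρ)^n` (`T₁ ≤ T₂`; equals
`Σ_{T₁<γ≤T₂} 2cos(nθ(γ))` when the zeros of the window lie on the critical line — never assumed). -/
def liZeroTraceWindow (n : ℕ) (T₁ T₂ : ℝ) : ℝ :=
  liZeroTrace n T₂ - liZeroTrace n T₁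

/-- The Riemann–von Mangoldt density `ϑ'(t) = ½ Re ψ(¼ + it/2) − ½ log π` (`ψ = Γ'/Γ = Complex.digamma`;
`N_smooth'(t) = ϑ'(t)/π`). -/
def liGammaDensity (t : ℝ) : ℝ :=
  (logDeriv Complex.Gamma (1 / 4 + (t : ℂ) / 2 * Complex.I)).re / 2 - Real.log Real.pi / 2

/-- The SMOOTH counterpart of the windowed trace: `(2/π) ∫_{T₁}^{T₂} cos(nθ(t)) ϑ'(t) dt`. -/
def liSmoothTraceWindow (n : ℕ) (T₁ T₂ : ℝ) : ℝ :=
  2 / Real.pi * ∫ t in T₁..T₂, Real.cos (n * liZeroAngle t) * liGammaDensity t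

/-- The echo amplitude of the prime 2: `A₂ = (log 2)^{1/4}/√(2π) = 0.36400…`. -/
def liEchoAmp : ℝ := Real.log 2 ^ (1 / 4 : ℝ) / Real.sqrt (2 * Real.pi)

/-- The ECHO of the prime power `m` in the Li kernel at parameter `n`:
`E_m(n) = π^{−1/2} Λ(m) m^{−1/2} (log m)^{−3/4} · n^{1/4} cos(2√(n log m) + π/4)` (stationary phase of
`n/t + t log m` at `t₀(m) = √(n/log m)`: phase value `2√(n log m)`, curvature `2(log m)^{3/2} n^{−1/2}`). -/
def liPrimeEcho (m n : ℕ) : ℝ :=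
  (Λ m : ℝ) / Real.sqrt m / Real.sqrt Real.pi * Real.log m ^ (-(3 / 4 : ℝ)) *
    ((n : ℝ) ^ (1 / 4 : ℝ) * Real.cos (2 * Real.sqrt (n * Real.log m) + Real.pi / 4))

/-- Glue (PROVED): `E_2(n) = A₂ · n^{1/4} cos(2√(n log 2) + π/4)`. -/
theorem liPrimeEcho_two (n : ℕ) :
    liPrimeEcho 2 n =
      liEchoAmp * ((n : ℝ) ^ (1 / 4 : ℝ) * Real.cos (2 * Real.sqrt (n * Real.log 2) + Real.pi / 4)) := by
  have h2 : 0 < Real.log 2 := Real.log_pos (by norm_num)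
  have hΛ : (Λ 2 : ℝ) = Real.log 2 := by
    rw [ArithmeticFunction.vonMangoldt_apply_prime Nat.prime_two]; norm_num
  have hpow : Real.log 2 * Real.log 2 ^ (-(3 / 4 : ℝ)) = Real.log 2 ^ (1 / 4 : ℝ) := by
    conv_lhs => rw [show Real.log 2 * Real.log 2 ^ (-(3 / 4 : ℝ))
        = Real.log 2 ^ (1 : ℝ) * Real.log 2 ^ (-(3 / 4 : ℝ)) by rw [Real.rpow_one]]
    rw [← Real.rpow_add h2]; norm_num
  have hsqrt : Real.sqrt 2 * Real.sqrt Real.pi = Real.sqrt (2 * Real.pi) := by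
    rw [Real.sqrt_mul (by norm_num : (0:ℝ) ≤ 2)]
  unfold liPrimeEcho liEchoAmp
  rw [hΛ, ← hpow, ← hsqrt]
  push_cast
  ring

/-! ## PART D — contour vocabulary (the pieces of Bombieri's rectangle the route's cruxes speak about) -/

/-- The Li weight `F_n(s) = (1 − 1/s)^n` (analytic off `s = 0`; `F_n(ρ) = z_ρ^n`). -/
def liWeight (n : ℕ) (s : ℂ) : ℂ := (1 - 1 / s) ^ n

/-- Bombieri's symmetrised weight `k_n(w) = F_n(w) + F_n(1 − w)` (`= 2cos(nθ(t))` on `Re w = ½`). -/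
def liSymWeight (n : ℕ) (w : ℂ) : ℂ := liWeight n w + liWeight n (1 - w)

/-- The point `3/2 + iy` of the right edge. -/
def liRightPt (y : ℝ) : ℂ := 3 / 2 + y * Complex.I

/-- `(1/π) Re ∫_{T₁}^{T₂} ξ'/ξ(3/2 + iy) k_n(3/2 + iy) dy` — the two vertical edges, the left one folded onto the
right by the functional equation and conjugation. -/
def liRightEdge (n : ℕ) (T₁ T₂ : ℝ) : ℝ :=
  1 / Real.pi * (∫ y in T₁..T₂, logDeriv riemannXi (liRightPt y) * liSymWeight n (liRightPt y)).re

/-- `(1/π) Im ∫_{−1/2}^{3/2} ξ'/ξ(x + iT) F_n(x + iT) dx` — one horizontal edge of the rectangle. -/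
def liHorizTerm (n : ℕ) (T : ℝ) : ℝ :=
  1 / Real.pi *
    (∫ x in (-(1 / 2 : ℝ))..(3 / 2 : ℝ),
      logDeriv riemannXi (x + T * Complex.I) * liWeight n (x + T * Complex.I)).im

/-- POLAR piece of the right edge: the weight against `1/w + 1/(w − 1)`. -/
def liPolarEdge (n : ℕ) (T₁ T₂ : ℝ) : ℝ :=
  1 / Real.pi *
    (∫ y in T₁..T₂, (1 / liRightPt y + 1 / (liRightPt y - 1)) * liSymWeight n (liRightPt y)).re

/-- GAMMA piece of the right edge: the weight against `−½ log π + ½ ψ(w/2)`. -/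
def liGammaEdge (n : ℕ) (T₁ T₂ : ℝ) : ℝ :=
  1 / Real.pi *
    (∫ y in T₁..T₂, (-(Real.log Real.pi : ℂ) / 2 + 1 / 2 * Complex.digamma (liRightPt y / 2)) *
      liSymWeight n (liRightPt y)).re

/-- PRIME piece of the right edge: the weight against `L(Λ, w) = Σ_m Λ(m) m^{−w}` (enters `ξ'/ξ` with a MINUS). -/
def liPrimeEdge (n : ℕ) (T₁ T₂ : ℝ) : ℝ :=
  1 / Real.pi *
    (∫ y in T₁..T₂, LSeries (fun m ↦ (Λ m : ℂ)) (liRightPt y) * liSymWeight n (liRightPt y)).re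

/-- The set of GOOD heights: `T` such that `ξ` has no zero on the closed segment `[−1/2, 3/2] × {T}` (every
`[T, T + 1]` contains good heights at distance `≫ 1/log T` from all ordinates — crux `LiHorizontalEdges`). -/
def liGoodHeights : Set ℝ :=
  {T : ℝ | ∀ x ∈ Set.Icc (-(1 / 2 : ℝ)) (3 / 2), riemannXi (x + T * Complex.I) ≠ 0}

/-! ## The rung leaf -/

/-- **RUNG LEAF «Li PRIME-ECHO LAW» (window form; RH-FREE for all `n`; PROOF-OF-DATA; NOT height-buying)** — T3d of
`theory/TARGETS.md` §7.10–§7.14.  For every fixed `c ≥ 5/4` (`> (log 2)^{−1/2} = 1.2011`, so the window `(√n, c√n]`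
contains the stationary height `t₀(2)` and no other `t₀(m)`):
`|Σ_{√n<|Im ρ|≤c√n} Re m_ρ (1 − 1/ρ)^n − (2/π)∫_{√n}^{c√n} cos(nθ)ϑ' + A₂ n^{1/4} cos(2√(n log 2) + π/4)| ≤ C_c log² n`
for all `n ≥ 2`.  DATA (zeros only): kit j241673 (`c = 2`, 2500 log-spaced `n ∈ [10⁴, 10⁶]`): free-fit amplitude 0.3639
(`A₂ = 0.3640`), phase 0.7923 (`π/4 = 0.7854`), corr 0.996 with the finite-`n` explicit-formula predictor, residual
rms 0.43–0.52 per half-decade; `c = 1.5 / 3.0`: 0.361 / 0.363.  KILL: a certified `n`-range on which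
`|window − smooth + E_2| / n^{1/4}` does not tend to 0, or a sign/constant mismatch in the contour bookkeeping (the
composition of the route's cruxes into this statement is kernel-checked, `theory/LiZeroWindowEchoSkeleton.lean`).
WHAT THIS IS NOT: not evidence for RH, not RH-sensitive, not a positivity statement. [folklore mechanism; statement new] -/
@[conjecture] def LiZeroWindowEcho : Prop :=
  ∀ c : ℝ, 5 / 4 ≤ c → ∃ C : ℝ, ∀ n : ℕ, 2 ≤ n →
    |liZeroTraceWindow n (Real.sqrt n) (c * Real.sqrt n)
        - liSmoothTraceWindow n (Real.sqrt n) (c * Real.sqrt n) + liPrimeEcho 2 n|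
      ≤ C * Real.log n ^ 2

/-! ## Companions of the leaf (typed targets of the echo family — NOT route items) and PROVED glue -/

/-- DATA FORM of the leaf (`c = 2`, amplitude spelled out; the object fitted by kit j241673): RH-FREE. -/
@[conjecture] def LiZeroWindowEchoTwo : Prop :=
  ∃ C : ℝ, ∀ n : ℕ, 2 ≤ n →
    |liZeroTraceWindow n (Real.sqrt n) (2 * Real.sqrt n) - liSmoothTraceWindow n (Real.sqrt n) (2 * Real.sqrt n)
        + liEchoAmp * ((n : ℝ) ^ (1 / 4 : ℝ) * Real.cos (2 * Real.sqrt (n * Real.log 2) + Real.pi / 4))|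
      ≤ C * Real.log n ^ 2

/-- Glue (PROVED): the leaf gives its data form. -/
theorem liZeroWindowEchoTwo_of (h : LiZeroWindowEcho) : LiZeroWindowEchoTwo := by
  obtain ⟨C, hC⟩ := h 2 (by norm_num)
  exact ⟨C, fun n hn ↦ by simpa only [liPrimeEcho_two] using hC n hn⟩

/-- BARE window echo (T3d⁻; RH-FREE): «the zeros of height `(√n, c√n]` ALONE chirp the prime 2» —
`|Σ_{√n<|Im ρ|≤c√n} Re m_ρ(1 − 1/ρ)^n + E_2(n)| ≤ C_c log² n` (the smooth counterpart is itself `O_c(log n)`). -/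
@[conjecture] def LiZeroWindowEchoBare : Prop :=
  ∀ c : ℝ, 5 / 4 ≤ c → ∃ C : ℝ, ∀ n : ℕ, 2 ≤ n →
    |liZeroTraceWindow n (Real.sqrt n) (c * Real.sqrt n) + liPrimeEcho 2 n| ≤ C * Real.log n ^ 2

/-- SMOOTH WINDOW BOUND (support-size target, RH-FREE, first-derivative test with the monotone amplitude `ϑ'` and
the phase `nθ(t)`, `|nθ'(t)| ≥ 4n/(4c²n + 1)`): `|(2/π)∫_{√n}^{c√n} cos(nθ)ϑ'| ≤ C_c log n` for fixed `c ≥ 1`. -/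
@[conjecture] def LiSmoothTraceWindowBound : Prop :=
  ∀ c : ℝ, 1 ≤ c → ∃ C : ℝ, ∀ n : ℕ, 2 ≤ n →
    |liSmoothTraceWindow n (Real.sqrt n) (c * Real.sqrt n)| ≤ C * Real.log n

/-- Glue (PROVED): the bare echo and the smooth bound give the leaf. -/
theorem liZeroWindowEcho_of_bare (h : LiZeroWindowEchoBare) (hs : LiSmoothTraceWindowBound) :
    LiZeroWindowEcho := by
  intro c hc
  obtain ⟨C₁, hC₁⟩ := h c hc
  obtain ⟨C₂, hC₂⟩ := hs c (by linarith)
  refine ⟨C₁ + |C₂| / Real.log 2, fun n hn ↦ ?_⟩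
  have h2 : 0 < Real.log 2 := Real.log_pos (by norm_num)
  have hlog : Real.log 2 ≤ Real.log n := Real.log_le_log (by norm_num) (by exact_mod_cast hn)
  have hlogpos : 0 < Real.log n := h2.trans_le hlog
  have hA := hC₁ n hn
  have hB := hC₂ n hn
  have hB' : |liSmoothTraceWindow n (Real.sqrt n) (c * Real.sqrt n)| ≤ |C₂| / Real.log 2 * Real.log n ^ 2 := by
    calc |liSmoothTraceWindow n (Real.sqrt n) (c * Real.sqrt n)| ≤ C₂ * Real.log n := hB
      _ ≤ |C₂| * Real.log n := mul_le_mul_of_nonneg_right (le_abs_self _) hlogpos.le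
      _ = |C₂| / Real.log 2 * (Real.log 2 * Real.log n) := by field_simp
      _ ≤ |C₂| / Real.log 2 * (Real.log n * Real.log n) := by
          apply mul_le_mul_of_nonneg_left _ (by positivity)
          exact mul_le_mul_of_nonneg_right hlog hlogpos.le
      _ = |C₂| / Real.log 2 * Real.log n ^ 2 := by ring
  calc |liZeroTraceWindow n (Real.sqrt n) (c * Real.sqrt n)
          - liSmoothTraceWindow n (Real.sqrt n) (c * Real.sqrt n) + liPrimeEcho 2 n|
        = |(liZeroTraceWindow n (Real.sqrt n) (c * Real.sqrt n) + liPrimeEcho 2 n)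
            - liSmoothTraceWindow n (Real.sqrt n) (c * Real.sqrt n)| := by ring_nf
    _ ≤ |liZeroTraceWindow n (Real.sqrt n) (c * Real.sqrt n) + liPrimeEcho 2 n|
          + |liSmoothTraceWindow n (Real.sqrt n) (c * Real.sqrt n)| := abs_sub _ _
    _ ≤ C₁ * Real.log n ^ 2 + |C₂| / Real.log 2 * Real.log n ^ 2 := add_le_add hA hB'
    _ = (C₁ + |C₂| / Real.log 2) * Real.log n ^ 2 := by ring

/-- SILENT WINDOW (T3d₀; RH-FREE; the zeroth step of the staircase): for `1 < c ≤ 23/20` (`< 1.2011`) the window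
`(√n, c√n]` contains no stationary height and the windowed trace IS its smooth counterpart up to `O_c(log² n)` — no
`n^{1/4}` term.  DATA: `c = 1.10`, 834 `n ∈ [10⁴, 10⁶]`: free-fit `n^{1/4}`-amplitude 0.006 (j241673); `c = 23/20`,
3000 `n ∈ [10⁴, 6·10⁶]`: rms per half-decade 1.69 … 2.23, no `n^{1/4}` growth (j242449). -/
@[conjecture] def LiZeroWindowSilent : Prop :=
  ∀ c : ℝ, 1 < c → c ≤ 23 / 20 → ∃ C : ℝ, ∀ n : ℕ, 2 ≤ n →
    |liZeroTraceWindow n (Real.sqrt n) (c * Real.sqrt n)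
        - liSmoothTraceWindow n (Real.sqrt n) (c * Real.sqrt n)|
      ≤ C * Real.log n ^ 2

/-- GENERAL ECHO LAW (T3e; RH-FREE; the column's structure statement for the oscillating part): «the zeros of height
`(c₁√n, c₂√n]` echo exactly the prime powers `m` with `c₂^{−2} ≤ log m < c₁^{−2}`».  For fixed `0 < c₁ < c₂` with no
stationary height on the window's edges,
`Σ_{c₁√n<|Im ρ|≤c₂√n} Re m_ρ(1 − 1/ρ)^n − (2/π)∫ cos(nθ)ϑ' = −Σ_{c₂^{−2} ≤ log m < c₁^{−2}} E_m(n) + O_{c₁,c₂}(log² n)`.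
DATA (zeros only, kit j242323/j242449, `n ≤ 6·10⁶`): window `(0.752√n, 1.08√n]` hears `m = 3, 4, 5` with amplitudes
0.3287 / 0.1510 / 0.2902 (pred 0.3335 / 0.1530 (`Λ(4) = log 2`) / 0.2842), phases 0.794 / 0.776 / 0.870 (pred `π/4`);
window `(0.818√n, 0.90√n]` hears ONLY `4 = 2²`.  Caveat: the implied constant blows up as an edge approaches a
stationary height (Fresnel leak `≈ a_m/(2x√π)` at `x` Fresnel widths). -/
@[conjecture] def LiZeroWindowEchoes : Prop :=
  ∀ c₁ c₂ : ℝ, 0 < c₁ → c₁ < c₂ →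
    (∀ m : ℕ, 2 ≤ m → (Λ m : ℝ) ≠ 0 → Real.log m ≠ 1 / c₁ ^ 2 ∧ Real.log m ≠ 1 / c₂ ^ 2) →
    ∃ C : ℝ, ∀ n : ℕ, 2 ≤ n →
      |liZeroTraceWindow n (c₁ * Real.sqrt n) (c₂ * Real.sqrt n)
          - liSmoothTraceWindow n (c₁ * Real.sqrt n) (c₂ * Real.sqrt n)
          + ∑ m ∈ Finset.Icc 2 ⌊Real.exp (1 / c₁ ^ 2)⌋₊,
              (if 1 / c₂ ^ 2 ≤ Real.log m then liPrimeEcho m n else 0)|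
        ≤ C * Real.log n ^ 2

/-- `⌊e⌋ = 2`: with `c₁ = 1` the general law sums over the single prime power `m = 2`. -/
theorem floor_exp_one_div_one_sq : ⌊Real.exp (1 / (1 : ℝ) ^ 2)⌋₊ = 2 := by
  rw [one_pow, div_one, Nat.floor_eq_iff (Real.exp_pos 1).le]
  have h1 := Real.exp_one_gt_d9
  have h2 := Real.exp_one_lt_d9
  constructor
  · norm_num at h1 ⊢; linarith
  · norm_num at h2 ⊢; linarith

/-- The edge hypothesis of `LiZeroWindowEchoes` for the window `(√n, c√n]` whenever `1 < c` and `log 2 ≠ 1/c²`. -/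
theorem liEchoes_edge_hyp {c : ℝ} (hc : 1 < c) (h2 : Real.log 2 ≠ 1 / c ^ 2) :
    ∀ m : ℕ, 2 ≤ m → (Λ m : ℝ) ≠ 0 → Real.log m ≠ 1 / (1 : ℝ) ^ 2 ∧ Real.log m ≠ 1 / c ^ 2 := by
  intro m hm _
  rw [one_pow, div_one]
  have hc1 : 1 / c ^ 2 < 1 := by
    rw [div_lt_one (by positivity)]; nlinarith
  rcases Nat.lt_or_ge m 3 with h | h
  · have hm2 : m = 2 := by omega
    subst hm2
    refine ⟨?_, by exact_mod_cast h2⟩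
    have := Real.log_two_lt_d9
    push_cast
    norm_num at this ⊢; linarith
  · -- `log m > 1` for `m ≥ 3` (the tree's `Literature.NumberTheory.DiophantineGeometry.one_lt_log_of_three_le`,
    -- re-derived inline to keep PART D's imports inside the L-function library)
    have h3 : (3 : ℝ) ≤ m := by exact_mod_cast h
    have h1 : 1 < Real.log m := by
      refine (Real.lt_log_iff_exp_lt (by positivity)).2 (lt_of_lt_of_le ?_ h3)
      have := Real.exp_one_lt_d9
      norm_num at this ⊢; linarith
    exact ⟨by linarith, by linarith⟩

/-- Glue (PROVED): the leaf is the `m = 2` instance (`c₁ = 1`, `c₂ = c ≥ 5/4`) of the general echo law. -/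
theorem liZeroWindowEcho_of_echoes (h : LiZeroWindowEchoes) : LiZeroWindowEcho := by
  intro c hc
  have hcsq : (25 : ℝ) / 16 ≤ c ^ 2 := by nlinarith
  have hc2 : 1 / c ^ 2 ≤ 16 / 25 := by
    have := one_div_le_one_div_of_le (by norm_num : (0 : ℝ) < 25 / 16) hcsq
    simpa using this
  have hlog2 : (0.69 : ℝ) < Real.log 2 := by
    have := Real.log_two_gt_d9; norm_num at this ⊢; linarith
  have hle : 1 / c ^ 2 ≤ Real.log 2 := by linarith
  obtain ⟨C, hC⟩ := h 1 c one_pos (by linarith) (liEchoes_edge_hyp (by linarith) (by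
    intro heq; linarith))
  refine ⟨C, fun n hn ↦ ?_⟩
  have key := hC n hn
  have hsum : (∑ m ∈ Finset.Icc 2 ⌊Real.exp (1 / (1 : ℝ) ^ 2)⌋₊,
      (if 1 / c ^ 2 ≤ Real.log m then liPrimeEcho m n else 0)) = liPrimeEcho 2 n := by
    rw [floor_exp_one_div_one_sq, Finset.Icc_self, Finset.sum_singleton, Nat.cast_ofNat, if_pos hle]
  rwa [hsum, one_mul] at key

/-- Glue (PROVED): the silent window is the EMPTY instance (`c₁ = 1`, `1 < c₂ ≤ 23/20`) of the general echo law. -/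
theorem liZeroWindowSilent_of_echoes (h : LiZeroWindowEchoes) : LiZeroWindowSilent := by
  intro c hc1 hc2
  have hc0 : 0 < c := by linarith
  have hcsq : c ^ 2 ≤ 529 / 400 := by nlinarith
  have hge : (400 : ℝ) / 529 ≤ 1 / c ^ 2 := by
    rw [div_le_div_iff₀ (by norm_num) (by positivity)]; nlinarith
  have hlog2 : Real.log 2 < (0.7 : ℝ) := by
    have := Real.log_two_lt_d9; norm_num at this ⊢; linarith
  have hlt : ¬ 1 / c ^ 2 ≤ Real.log 2 := not_le.2 (by linarith)
  obtain ⟨C, hC⟩ := h 1 c one_pos hc1 (liEchoes_edge_hyp hc1 (by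
    intro heq; linarith))
  refine ⟨C, fun n hn ↦ ?_⟩
  have key := hC n hn
  have hsum : (∑ m ∈ Finset.Icc 2 ⌊Real.exp (1 / (1 : ℝ) ^ 2)⌋₊,
      (if 1 / c ^ 2 ≤ Real.log m then liPrimeEcho m n else 0)) = 0 := by
    rw [floor_exp_one_div_one_sq, Finset.Icc_self, Finset.sum_singleton, Nat.cast_ofNat, if_neg hlt]
  rwa [hsum, add_zero, one_mul] at key

end Summit.RiemannHypothesis.RiemannHypothesis.Theorems.LiTheory

end
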